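import Summits.QuantumFields.BalabanUV.T4Continuum.Spine.NE3.TangentProjectionSlicB8
import Summits.QuantumFields.BalabanUV.T4Continuum.Spine.NE3.LandauProjectionB8
import Summits.QuantumFields.BalabanUV.T4Continuum.Support.NE3HodgeCoexactPoincareEnd
import Summits.QuantumFields.BalabanUV.T4Continuum.Support.NE3LandauOrbit
import Summits.QuantumFields.BalabanUV.T4Continuum.Support.NE3CornerGaugePoincare
import Summits.QuantumFields.BalabanUV.T4Continuum.Support.NE3NestedBlockMeanCovariance
import Summits.QuantumFields.BalabanUV.T4Continuum.Support.NE3FramePotGauge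
import Summits.QuantumFields.BalabanUV.T4Continuum.Support.NE3FrameFreeSliceUnique
import Summits.QuantumFields.BalabanUV.T4Continuum.Support.NE3FlatHessianCurl
import Summits.QuantumFields.BalabanUV.T4Continuum.Support.NE3ClassRadiusFamily
import Summits.QuantumFields.BalabanUV.T4Continuum.Support.NE3FlatHodgeSplit
import Summits.QuantumFields.BalabanUV.T4Continuum.Support.NE3CurvedCornerGaugeSpace
import HarnessLib

/-!
# T⁴ programme, node NE3 — census R30: (P♮) ON B8's SLICE `slicB8` HOLDS AT THE FLAT BACKGROUND ON THE UNIT TORUS (N = 1), k-UNIFORMLY,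
# with constant `9·card n` — the END's per-pair hypothesis `hP` is satisfiable at the flat datum (non-vacuity of the [B9] Thm 3.3 TYPE shape)

Cell `pub-balaban-gaps` (track G2, seat `ne3`; writer prover-pub-balaban-gaps-ne3-g5-0, 2026-08-23), census `run/shared/lean/pub/pub-balaban-gaps/ne/NE3.md` §4 R30 ∕ §11.
WHAT.  THE END (`PairLandauB8EndSfClassTowers.ne3EnergyRateWCov_sfClass_towers`, with its numeric lines discharged in `EndLinesNonVacuous`) asks, per pair,
`SlicePoincare L (j+1) W (slicB8 L N (j+1) W) CP (periodBox (N·L^{j+1}))` — the weighted Poincaré inequality `ξ²·dirSq Y ≤ CP·curlSq_W Y` on B8's tangent slice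
(`QbarIter = 0` ∧ (1.38)-Landau), modelled on [Balaban1985BackgroundPropagators] Thm 3.3 (3.46).  THIS FILE PROVES IT AT THE FLAT BACKGROUND `W = flatCfg` ON THE UNIT TORUS
`N = 1` for every `L ≥ 2` and every level `j`, with the k-FREE constant `9·card n`:
**`slicePoincare_slicB8_flatCfg_unit`** : `SlicePoincare L (j+1) flatCfg (slicB8 L 1 (j+1) flatCfg) (9·card n) (periodBox (1·L^{j+1}))`.
MECHANISM.  (i) **`covDiv_eq_zero_of_isLandauB8_flatCfg_unit`**: at `N = 1` the (1.38) test space `N(Q′(1))` contains the flat divergence `ρ := covDiv 1 Y` itself (skew,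
periodic, and its nested block mean `bmeanIterW L (j+1) 1 ρ = (bmean L)^[j+1] ρ` is the TOTAL mean of a divergence, `= 0`); testing (1.38) against `μ := ρ` gives, by the
torus summation by parts `sum_hsR_gaugeDir` (twice) and `covDiv ∘ gaugeDir = covLapSite`, `Σ‖D ρ‖² = 0`, and the corner-gauge Poincaré inequality of `N(Q′)` (K6-Ξ,
`sum_nhsNormSq_le_four_mul_of_bmeanIterW_eq_zero`) then forces `ρ = 0`: a (1.38)-Landau direction on the unit torus is CO-CLOSED.  (ii) For `Y ∈ slicB8(1)` the
corner spike `ζ` of the accumulated frames (R25, `tangentIter_sub_gaugeDir_of_QbarIter_eq_zero`) makes `Y′ := Y − gaugeDir 1 ζ = Y + dPot ζ` tangent to the PLAIN fibre, with the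
same flat curl and with `Y′ − dPot ζ = Y` co-closed by (i); the tree's N-FREE block-Poincaré of the co-closed Hodge component of a flat tangent direction
(`NE3HodgeCoexactPoincareEnd.sum_nhsNormSq_coexact_le_curl`: `Σ nhsNormSq (Y′ − dPot ζ) ≤ 9·(L^{j+1})²·Σ nhsNormSq (curlAt 1 Y′)`) is then exactly the claim, after
`dirSq ≤ card n·Σ nhsNormSq` and `Σ_π nhsNormSq (curlAt) ≤ curlSq`.  No smallness, no constant of Bałaban's; `x = 0` throughout (`smallField_flatCfg_zero`).
SCOPE.  `N = 1` only: for `N ≥ 2` the (1.38)-exact sector is non-trivial (a constrained biharmonic extension of block means) — numerically (census R30, kit jobs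
j191499 ∕ j191882; d ∈ {3, 4}, L ∈ {2, 3}, N ≤ 3, float) the lowest mode of `ξ⁻²·curlSq` on `slicB8(1)` is CO-CLOSED in every case computed (for N ≤ 2 its eigenvalue is the
lowest coexact eigenvalue `4sin²(π∕(NM))` of the fine torus) and `CP(k)` does not grow with `k` (table in the census); a k-uniform Lean proof of that sector is census R32 (M–L).

CONTENT (0 sorry, no `def`): `levelSmall_zero`, `cornerSmall_zero`, `flatCfg_eq_one`, `bmeanIterW_flatCfg_eq_zero_of_sum_eq_zero`, `sum_covDiv_flatCfg_eq_zero`,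
**`covDiv_eq_zero_of_isLandauB8_flatCfg_unit`**, **`slicePoincare_slicB8_flatCfg_unit`** [folklore].

HONEST FRAMING.  A statement about OUR slice at the TRIVIAL background on the one-block torus: it shows the END's hypothesis SHAPE `hP` is satisfiable (as
`pairLandauGaugeB8Avg_flat` does for `hB8`), nothing about curved backgrounds or Bałaban's minimisers; (P♮) on `slicB8` at `W = cavg L U_B` stays the printed-TYPE
hypothesis; **NE3 is NOT proved**; spine PROVED 0∕9; finite T⁴ rung (B)+1 — NOT continuum YM on ℝ⁴, NOT infinite volume, NOT mass gap, NOT Clay.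
PLACEMENT: `Summits/QuantumFields/BalabanUV/T4Continuum/Spine/NE3/`.
-/

set_option autoImplicit false

open scoped BigOperators Matrix Matrix.Norms.L2Operator
open Finset

namespace Summit.QuantumFields.BalabanUV.T4Continuum.NE3.SlicePoincareSlicB8Flat

open Literature.MathematicalPhysics.QuantumFieldTheory.Balaban1983to89
open B7Prop1Explicit B7Prop2Explicit
open T4AveragingDeficitWall (IsUnitaryCfg IsSkewDir SmallField Ad Plane curlAt curlSq dirSq)
open T4AveragingDeficitWallBoundary (IsPeriodicCfg periodBox mem_periodBox)
open AveragingDeficitPeriodicCounting (IsPeriodicDir)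
open AveragingDeficitMultiLevelPrep (TangentIter tower LevelSmall)
open AveragingDeficitTwoLevelPrep (prop1Radius twoLevelSmall)
open SpreadLift (loopRad)
open BlockAveragePushDirGauge (gaugeDir isPeriodicDir_gaugeDir)
open BlockAveragePushDirSplit (flat)
open MinimalActionWitness (flatCfg isPeriodicCfg_flatCfg)
open NE3TangentCovariantTower (QbarIter framePotW)
open NE3CurvedFrameKill (framePotW_skew_periodic)
open NE3FramePotBoundW (tower_eq_pow_mul)
open NE3TangentNoGoWords (dPot)
open NE3CoercivityScaling (flatDiv)
open MatrixNorms (nhsNormSq nhsNormSq_nonneg)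
open NE3CovariantCalculus (hsR hsR_self hsR_comm)
open NE3CovariantWeitzenbock (covDiv)
open NE3CovariantBlockMean (bmeanIterW)
open NE3NestedBlockMeanCovariance (bmeanIterW_one)
open NE3FramePotGauge (bmean iterate_bmean_apply)
open NE3LandauOrbit (sum_hsR_gaugeDir covDiv_add_period eq_zero_of_nhsNormSq_eq_zero)
open NE3CornerGaugePoincare (sum_nhsNormSq_le_four_mul_of_bmeanIterW_eq_zero)
open NE3FrameFreeSliceUnique (gaugeDir_flatCfg_eq_neg_dPot covDiv_flatCfg_eq_flatDiv eq_zero_of_periodic_of_box)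
open NE3FlatHessianCurl (isUnitaryCfg_flatCfg smallField_flatCfg_zero)
open NE3ClassRadiusFamily (levelSmall_of_small)
open NE3FlatHodgeSplit (sum_periodBox_div_eq_zero periodic_vec')
open NE3CurvedCornerGaugeSpace (covDiv_mem_skewAdjoint)
open NE3BlockPoincareTangent (dirSq_le_card_mul_sum_nhs)
open NE3FlatWeightedCoercive (sum_nhsNormSq_curl_le_curlSq)
open NE3HodgeCoexactPoincareEnd (sum_nhsNormSq_coexact_le_curl curlAt_flatCfg_coexact)
open NE3SlicePoincareShape (SlicePoincare)
open NE3.PairLandauB8 (covLapSite avgKernelGauges IsLandauB8)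
open NE3.LandauProjectionB8 (covDiv_gaugeDir_eq_covLapSite covLapSite_add_period)
open NE3.TangentProjectionSlicB8 (tangentIter_sub_gaugeDir_of_QbarIter_eq_zero)
open NE3.PairLandauB8Avg (slicB8 mem_slicB8_iff)

noncomputable section

variable {d : ℕ} {n : Type*} [Fintype n] [DecidableEq n]

/-! ## §1 The class data at radius `x = 0` -/

/-- `LevelSmall d L j 0` (`L ≥ 2`). [folklore] -/
theorem levelSmall_zero {L : ℕ} (hL : 2 ≤ L) (j : ℕ) : LevelSmall d L j 0 :=
  levelSmall_of_small hL j le_rfl (by simp) (by simp)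

omit [DecidableEq n] in
/-- The K6-Ξ smallness line at `x = 0`: both radii vanish. [folklore] -/
theorem cornerSmall_zero (L : ℕ) (j : ℕ) :
    8 * d * (((L : ℝ) ^ (j + 1)) * (((d : ℝ) - 1) * (((L : ℝ) ^ (j + 1)) - 1) * 0)) ^ 2
      + 2 * (Fintype.card n * (4 * (d : ℝ) ^ 2 * ((L : ℝ) ^ (j + 1) - 1) ^ 2 * 0 + 16 * d * loopRad d L ((prop1Radius d L)^[j] 0)) ^ 2)
        ≤ 1 / 2 := by
  have h0 : (prop1Radius d L)^[j] 0 = 0 := Function.iterate_fixed (by simp [prop1Radius]) j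
  rw [h0]
  simp [loopRad]

/-! ## §2 On the unit torus a (1.38)-Landau direction at the flat background is co-closed -/

/-- `flatCfg = 1`. [folklore] -/
theorem flatCfg_eq_one : (flatCfg : Site d → Fin d → (Matrix n n ℂ)ˣ) = 1 := rfl

/-- The nested block mean at the flat background of an `M`-periodic site field with vanishing total over the period box vanishes (`M = L^{j+1}`, one
block = the whole unit torus). [folklore] -/
theorem bmeanIterW_flatCfg_eq_zero_of_sum_eq_zero {L : ℕ} (hL : 1 ≤ L) (j : ℕ) {ρ : Site d → Matrix n n ℂ}
    (hρP : ∀ (x : Site d) (τ : Fin d), ρ (x + ((L ^ (j + 1) : ℕ) : ℤ) • e τ) = ρ x)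
    (hsum : ∑ v ∈ periodBox (d := d) (L ^ (j + 1)), ρ v = 0) :
    bmeanIterW L (j + 1) (flatCfg : Site d → Fin d → (Matrix n n ℂ)ˣ) ρ = 0 := by
  funext z
  rw [flatCfg_eq_one, bmeanIterW_one, iterate_bmean_apply hL (j + 1) ρ z]
  have hshift : ∑ v ∈ periodBox (d := d) (L ^ (j + 1)), ρ (((L ^ (j + 1) : ℕ) : ℤ) • z + v)
      = ∑ v ∈ periodBox (d := d) (L ^ (j + 1)), ρ v := by
    refine Finset.sum_congr rfl fun v _ => ?_
    rw [add_comm]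
    exact periodic_vec' hρP v z
  rw [hshift, hsum, smul_zero]
  rfl

/-- The total of the flat divergence over the period box vanishes (entrywise `NE3FlatHodgeSplit.sum_periodBox_div_eq_zero`). [folklore] -/
theorem sum_covDiv_flatCfg_eq_zero {P : ℕ} (hP : 1 ≤ P) {Y : Site d → Fin d → Matrix n n ℂ} (hYP : IsPeriodicDir Y (P : ℤ)) :
    ∑ x ∈ periodBox (d := d) P, covDiv (flatCfg : Site d → Fin d → (Matrix n n ℂ)ˣ) Y x = 0 := by
  ext p q
  simp only [covDiv_flatCfg_eq_flatDiv, flatDiv, Matrix.sum_apply, Matrix.sub_apply, Matrix.zero_apply]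
  exact sum_periodBox_div_eq_zero hP (fun x κ => Y x κ p q) (fun x τ μ => by rw [hYP x τ μ])

/-- **A (1.38)-LANDAU DIRECTION ON THE UNIT TORUS AT THE FLAT BACKGROUND IS CO-CLOSED**: `IsLandauB8 L 1 (j+1) 1 Y` for skew `L^{j+1}`-periodic `Y` forces
`covDiv 1 Y = 0` everywhere (module docstring (i)). [folklore] -/
theorem covDiv_eq_zero_of_isLandauB8_flatCfg_unit [Nonempty n] {L : ℕ} (hL : 2 ≤ L) (j : ℕ)
    {Y : Site d → Fin d → Matrix n n ℂ} (hYs : IsSkewDir Y) (hYP : IsPeriodicDir Y ((1 * L ^ (j + 1) : ℕ) : ℤ))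
    (hLan : IsLandauB8 (d := d) L 1 (j + 1) (flatCfg : Site d → Fin d → (Matrix n n ℂ)ˣ) Y) :
    ∀ x : Site d, covDiv (flatCfg : Site d → Fin d → (Matrix n n ℂ)ˣ) Y x = 0 := by
  have hL1 : 1 ≤ L := le_trans (by norm_num) hL
  set P : ℕ := 1 * L ^ (j + 1) with hPdef
  have hPM : P = L ^ (j + 1) := Nat.one_mul _
  have hP : 1 ≤ P := by rw [hPM]; exact Nat.one_le_pow _ _ (by omega)
  have hWu : IsUnitaryCfg (flatCfg : Site d → Fin d → (Matrix n n ℂ)ˣ) := isUnitaryCfg_flatCfg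
  have hWP : IsPeriodicCfg (flatCfg : Site d → Fin d → (Matrix n n ℂ)ˣ) (P : ℤ) := isPeriodicCfg_flatCfg _
  -- the flat divergence `ρ`: skew, periodic, of vanishing nested block mean — a member of `N(Q′(1))`
  set ρ : Site d → Matrix n n ℂ := covDiv (flatCfg : Site d → Fin d → (Matrix n n ℂ)ˣ) Y with hρ
  have hρP : ∀ (x : Site d) (τ : Fin d), ρ (x + (P : ℤ) • e τ) = ρ x := covDiv_add_period hWP hYP
  have hρs : ∀ x, ρ x ∈ skewAdjoint (Matrix n n ℂ) := fun x => covDiv_mem_skewAdjoint hWu hYs x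
  have hρP' : ∀ (x : Site d) (τ : Fin d), ρ (x + ((L ^ (j + 1) : ℕ) : ℤ) • e τ) = ρ x := by rw [← hPM]; exact hρP
  have hρmean : bmeanIterW L (j + 1) (flatCfg : Site d → Fin d → (Matrix n n ℂ)ˣ) ρ = 0 :=
    bmeanIterW_flatCfg_eq_zero_of_sum_eq_zero hL1 j hρP' (by rw [← hPM]; exact sum_covDiv_flatCfg_eq_zero hP hYP)
  have hρN : ρ ∈ avgKernelGauges (d := d) (n := n) L 1 (j + 1) (flatCfg : Site d → Fin d → (Matrix n n ℂ)ˣ) := ⟨hρs, hρP, hρmean⟩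
  -- test (1.38) against `μ := ρ`
  have hlapP : ∀ (x : Site d) (τ : Fin d), covLapSite (flatCfg : Site d → Fin d → (Matrix n n ℂ)ˣ) ρ (x + (P : ℤ) • e τ)
      = covLapSite (flatCfg : Site d → Fin d → (Matrix n n ℂ)ˣ) ρ x :=
    covLapSite_add_period hWP hρP
  have h0 := hLan ρ hρN
  rw [sum_hsR_gaugeDir hP hWu hYP hlapP] at h0
  -- `Σ‖D ρ‖² = Σ hsR (covLapSite ρ) ρ = 0`
  have hGP : IsPeriodicDir (gaugeDir (flatCfg : Site d → Fin d → (Matrix n n ℂ)ˣ) ρ) (P : ℤ) := isPeriodicDir_gaugeDir hWP hρP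
  have h1 := sum_hsR_gaugeDir hP hWu hGP hρP
  rw [covDiv_gaugeDir_eq_covLapSite] at h1
  have h2 : ∑ x ∈ periodBox (d := d) P, ∑ μ : Fin d, nhsNormSq (gaugeDir (flatCfg : Site d → Fin d → (Matrix n n ℂ)ˣ) ρ x μ) = 0 := by
    have h3 : ∑ x ∈ periodBox (d := d) P, hsR (covLapSite (flatCfg : Site d → Fin d → (Matrix n n ℂ)ˣ) ρ x) (ρ x) = 0 := by
      rw [← h0]; exact Finset.sum_congr rfl fun x _ => hsR_comm _ _
    rw [← h3, ← h1]
    exact Finset.sum_congr rfl fun x _ => Finset.sum_congr rfl fun μ _ => (hsR_self _).symm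
  -- the corner-gauge Poincaré inequality of `N(Q′)` forces `ρ = 0` on the period box
  have hK := sum_nhsNormSq_le_four_mul_of_bmeanIterW_eq_zero hL j hWu le_rfl (levelSmall_zero hL j) smallField_flatCfg_zero 1 ρ
    (fun z _ => by rw [hρmean]; rfl) (cornerSmall_zero (n := n) L j)
  rw [show L ^ (j + 1) * 1 = P by rw [hPM, Nat.mul_one], h2, mul_zero, mul_zero] at hK
  have hbox : ∀ x ∈ periodBox (d := d) P, ρ x = 0 := by
    have hle := (Finset.sum_eq_zero_iff_of_nonneg fun x _ => nhsNormSq_nonneg (ρ x)).1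
      (le_antisymm hK (Finset.sum_nonneg fun x _ => nhsNormSq_nonneg (ρ x)))
    exact fun x hx => eq_zero_of_nhsNormSq_eq_zero (hle x hx)
  exact eq_zero_of_periodic_of_box hP hρP hbox

/-! ## §3 (P♮) on `slicB8` at the flat background on the unit torus -/

/-- **(P♮) ON B8's SLICE AT THE FLAT BACKGROUND ON THE UNIT TORUS, k-UNIFORM**:
`SlicePoincare L (j+1) flatCfg (slicB8 L 1 (j+1) flatCfg) (9·card n) (periodBox (1·L^{j+1}))` for every `L ≥ 2` and every `j` (module docstring (ii)). [folklore] -/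
theorem slicePoincare_slicB8_flatCfg_unit [Nonempty n] {L : ℕ} (hL : 2 ≤ L) (j : ℕ) :
    SlicePoincare L (j + 1) (flatCfg : Site d → Fin d → (Matrix n n ℂ)ˣ) (slicB8 (d := d) (n := n) L 1 (j + 1) flatCfg)
      (9 * Fintype.card n) (periodBox (d := d) (1 * L ^ (j + 1))) := by
  intro Y hY
  obtain ⟨hYs, hYP, hLan, hQ⟩ := (mem_slicB8_iff (d := d) (n := n)).1 hY
  have hL1 : 1 ≤ L := le_trans (by norm_num) hL
  set M : ℕ := L ^ (j + 1) with hM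
  have hMpos : 0 < M := by rw [hM]; positivity
  have hM0 : (M : ℤ) ≠ 0 := by exact_mod_cast hMpos.ne'
  have hMZ : ((M : ℕ) : ℤ) = (L : ℤ) ^ (j + 1) := by rw [hM]; push_cast; rfl
  have hPM : 1 * L ^ (j + 1) = M := Nat.one_mul _
  have htower : tower L 1 (j + 1) = M := by rw [tower_eq_pow_mul, Nat.mul_one]
  have hWu : IsUnitaryCfg (flatCfg : Site d → Fin d → (Matrix n n ℂ)ˣ) := isUnitaryCfg_flatCfg
  have hWP_T : IsPeriodicCfg (flatCfg : Site d → Fin d → (Matrix n n ℂ)ˣ) ((tower L 1 (j + 1) : ℕ) : ℤ) := isPeriodicCfg_flatCfg _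
  have hWP_M : IsPeriodicCfg (flatCfg : Site d → Fin d → (Matrix n n ℂ)ˣ) ((1 * L ^ (j + 1) : ℕ) : ℤ) := isPeriodicCfg_flatCfg _
  have hYP_T : IsPeriodicDir Y ((tower L 1 (j + 1) : ℕ) : ℤ) := by rw [htower, ← hPM]; exact hYP
  have hs0 : LevelSmall d L j 0 := levelSmall_zero hL j
  -- the accumulated frames and their corner spike (as in `TangentProjectionSlicB8`)
  obtain ⟨hfs, hfP⟩ := framePotW_skew_periodic (M := 1) hL1 j hWu hWP_T le_rfl hs0 smallField_flatCfg_zero hYs hYP_T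
  set f : Site d → Matrix n n ℂ := framePotW L (j + 1) (flatCfg : Site d → Fin d → (Matrix n n ℂ)ˣ) Y with hf
  set ζ : Site d → Matrix n n ℂ := fun y => if (∀ i, (M : ℤ) ∣ y i) then f (fun i => y i / (M : ℤ)) else 0 with hζ
  have hζ_of : ∀ y : Site d, (∀ i, (M : ℤ) ∣ y i) → ζ y = f (fun i => y i / (M : ℤ)) := fun y h => by
    simp only [hζ, if_pos h]
  have hζ_off : ∀ y : Site d, ¬ (∀ i, (M : ℤ) ∣ y i) → ζ y = 0 := fun y h => by
    simp only [hζ, if_neg h]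
  have hcorner' : ∀ z : Site d, ζ (((L : ℤ) ^ (j + 1)) • z) = framePotW L (j + 1) (flatCfg : Site d → Fin d → (Matrix n n ℂ)ˣ) Y z := by
    intro z
    have hdiv : ∀ i, (M : ℤ) ∣ ((M : ℤ) • z) i := fun i => by
      simp only [Pi.smul_apply, smul_eq_mul]; exact dvd_mul_right _ _
    rw [← hMZ, hζ_of _ hdiv]
    show f _ = f z
    congr 1
    funext i
    simp only [Pi.smul_apply, smul_eq_mul]
    exact Int.mul_ediv_cancel_left _ hM0
  have hζs : ∀ y, ζ y ∈ skewAdjoint (Matrix n n ℂ) := by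
    intro y
    by_cases hdiv : ∀ i, (M : ℤ) ∣ y i
    · rw [hζ_of y hdiv]; exact hfs _
    · rw [hζ_off y hdiv]; exact (skewAdjoint (Matrix n n ℂ)).zero_mem
  have hζP : ∀ (y : Site d) (i : Fin d), ζ (y + ((M * 1 : ℕ) : ℤ) • e i) = ζ y := by
    intro y i
    have hcoord : ∀ k : Fin d, (y + ((M * 1 : ℕ) : ℤ) • e i) k = y k + (M : ℤ) * ((1 : ℤ) * e i k) := by
      intro k; simp only [Pi.add_apply, Pi.smul_apply, smul_eq_mul]; push_cast; ring
    have hdiv_iff : (∀ k, (M : ℤ) ∣ (y + ((M * 1 : ℕ) : ℤ) • e i) k) ↔ ∀ k, (M : ℤ) ∣ y k := by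
      refine forall_congr' fun k => ?_
      rw [hcoord]
      constructor
      · intro h
        have h' := dvd_sub h (dvd_mul_right (M : ℤ) ((1 : ℤ) * e i k))
        rwa [add_sub_cancel_right] at h'
      · intro h
        exact dvd_add h (dvd_mul_right _ _)
    by_cases hdiv : ∀ k, (M : ℤ) ∣ y k
    · rw [hζ_of _ (hdiv_iff.mpr hdiv), hζ_of _ hdiv]
      have hq : (fun k => (y + ((M * 1 : ℕ) : ℤ) • e i) k / (M : ℤ)) = (fun k => y k / (M : ℤ)) + (1 : ℤ) • e i := by
        funext k
        rw [hcoord, Int.add_mul_ediv_left _ _ hM0]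
        simp only [Pi.add_apply, Pi.smul_apply, smul_eq_mul]
      rw [hq]
      have := hfP (fun k => y k / (M : ℤ)) i
      simpa using this
    · rw [hζ_off _ hdiv, hζ_off _ (fun h => hdiv (hdiv_iff.mp h))]
  have hζP_T : ∀ (y : Site d) (i : Fin d), ζ (y + ((tower L 1 (j + 1) : ℕ) : ℤ) • e i) = ζ y := by
    rw [htower, ← Nat.mul_one M]; exact hζP
  have hζP_P : ∀ (y : Site d) (i : Fin d), ζ (y + ((1 * L ^ (j + 1) : ℕ) : ℤ) • e i) = ζ y := by
    rw [hPM, ← Nat.mul_one M]; exact hζP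
  -- the plain-fibre tangent representative `Y′ = Y − gaugeDir 1 ζ = Y + dPot ζ`
  have hT := tangentIter_sub_gaugeDir_of_QbarIter_eq_zero (N := 1) hL1 j hWu hWP_T le_rfl hs0 smallField_flatCfg_zero hYs hYP_T
    hQ hζs hζP_T hcorner'
  set Y' : Site d → Fin d → Matrix n n ℂ := fun y κ => Y y κ - dPot (fun y => -ζ y) y κ with hY'
  have hY'eq : Y - gaugeDir (flatCfg : Site d → Fin d → (Matrix n n ℂ)ˣ) ζ = Y' := by
    funext y κ
    simp only [hY', Pi.sub_apply, gaugeDir_flatCfg_eq_neg_dPot, dPot]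
    abel
  have hT' : TangentIter L j (flat (d := d) (n := n)) Y' := by
    rw [← hY'eq]; exact hT
  have hY'P : IsPeriodicDir Y' ((1 * L ^ (j + 1) : ℕ) : ℤ) := by
    rw [← hY'eq]
    intro y τ μ
    have h1 : Y (y + ((1 * L ^ (j + 1) : ℕ) : ℤ) • e τ) μ = Y y μ := hYP y τ μ
    have h2 := isPeriodicDir_gaugeDir hWP_M hζP_P y τ μ
    simp only [Pi.sub_apply, h1, h2]
  have hY'sub : ∀ (y : Site d) (κ : Fin d), Y' y κ - dPot ζ y κ = Y y κ := by
    intro y κ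
    simp only [hY', dPot]
    abel
  -- `Y′ − dPot ζ = Y` is co-closed: §2
  have hdivY := covDiv_eq_zero_of_isLandauB8_flatCfg_unit hL j hYs hYP hLan
  have hdiv : ∀ x : Site d, flatDiv (fun y μ => Y' y μ - dPot ζ y μ) x = 0 := by
    intro x
    have hfun : (fun y μ => Y' y μ - dPot ζ y μ) = Y := by funext y μ; exact hY'sub y μ
    rw [hfun, ← covDiv_flatCfg_eq_flatDiv]
    exact hdivY x
  -- the N-free block-Poincaré of the co-closed component of the flat tangent direction `Y′`
  have h := sum_nhsNormSq_coexact_le_curl hL1 (N := 1) le_rfl hY'P hT' hζP_P hdiv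
  have hlhs : ∑ x ∈ periodBox (d := d) (1 * L ^ (j + 1)), ∑ κ : Fin d, nhsNormSq (Y' x κ - dPot ζ x κ)
      = ∑ x ∈ periodBox (d := d) (1 * L ^ (j + 1)), ∑ κ : Fin d, nhsNormSq (Y x κ) :=
    Finset.sum_congr rfl fun x _ => Finset.sum_congr rfl fun κ _ => by rw [hY'sub]
  have hcurl : ∀ (x : Site d) (π : Plane d),
      curlAt (flatCfg (d := d) (n := n)) Y' x π.1.1 π.1.2 = curlAt (flatCfg (d := d) (n := n)) Y x π.1.1 π.1.2 :=
    fun x π => curlAt_flatCfg_coexact Y (fun y => -ζ y) x π.1.1 π.1.2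
  rw [hlhs] at h
  simp_rw [hcurl] at h
  -- currencies: `dirSq ≤ card n·Σ nhsNormSq`, `Σ_π nhsNormSq (curlAt) ≤ curlSq`, and `ξ²·M² = 1`
  have hcard : (0 : ℝ) ≤ Fintype.card n := Nat.cast_nonneg _
  have hMR : (0 : ℝ) < (L : ℝ) ^ (j + 1) := by positivity
  have hξ : (((L : ℝ) ^ (j + 1))⁻¹) ^ 2 * ((L : ℝ) ^ (j + 1)) ^ 2 = 1 := by
    rw [← mul_pow, inv_mul_cancel₀ hMR.ne', one_pow]
  calc (((L : ℝ) ^ (j + 1))⁻¹) ^ 2 * dirSq Y (periodBox (d := d) (1 * L ^ (j + 1)))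
      ≤ (((L : ℝ) ^ (j + 1))⁻¹) ^ 2 * (Fintype.card n * ∑ x ∈ periodBox (d := d) (1 * L ^ (j + 1)), ∑ κ : Fin d, nhsNormSq (Y x κ)) :=
        mul_le_mul_of_nonneg_left (dirSq_le_card_mul_sum_nhs _ _) (by positivity)
    _ ≤ (((L : ℝ) ^ (j + 1))⁻¹) ^ 2 * (Fintype.card n * (9 * ((L : ℝ) ^ (j + 1)) ^ 2
          * ∑ x ∈ periodBox (d := d) (1 * L ^ (j + 1)), ∑ π : Plane d, nhsNormSq (curlAt (flatCfg (d := d) (n := n)) Y x π.1.1 π.1.2))) :=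
        mul_le_mul_of_nonneg_left (mul_le_mul_of_nonneg_left h hcard) (by positivity)
    _ ≤ (((L : ℝ) ^ (j + 1))⁻¹) ^ 2 * (Fintype.card n * (9 * ((L : ℝ) ^ (j + 1)) ^ 2
          * curlSq (flatCfg (d := d) (n := n)) Y (periodBox (d := d) (1 * L ^ (j + 1))))) :=
        mul_le_mul_of_nonneg_left (mul_le_mul_of_nonneg_left
          (mul_le_mul_of_nonneg_left (sum_nhsNormSq_curl_le_curlSq Y _) (by positivity)) hcard) (by positivity)
    _ = 9 * Fintype.card n * curlSq (flatCfg (d := d) (n := n)) Y (periodBox (d := d) (1 * L ^ (j + 1))) := by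
        rw [show (((L : ℝ) ^ (j + 1))⁻¹) ^ 2 * (Fintype.card n * (9 * ((L : ℝ) ^ (j + 1)) ^ 2
            * curlSq (flatCfg (d := d) (n := n)) Y (periodBox (d := d) (1 * L ^ (j + 1)))))
            = ((((L : ℝ) ^ (j + 1))⁻¹) ^ 2 * ((L : ℝ) ^ (j + 1)) ^ 2) * (9 * Fintype.card n
              * curlSq (flatCfg (d := d) (n := n)) Y (periodBox (d := d) (1 * L ^ (j + 1)))) by ring, hξ, one_mul]

end

end Summit.QuantumFields.BalabanUV.T4Continuum.NE3.SlicePoincareSlicB8Flat
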